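import Summits.QuantumFields.YangMills.Theorems.BrascampLiebVacuum.Negative.WilsonTorusToolkit
import Literature.MathematicalPhysics.QuantumLattice.HeatKernelGroupMeasureProofs

/-!
# `ConvexGribovBody.BrascampLiebVacuum` — negative lemma: connectedness of the gauge group is
load-bearing; the crux's shape is false for every finite (discrete) gauge group
(refuter, crux stmt-QuantumFields-8779)

The route's Barriers paragraph asserts: "for finite `G` the link metric slope is void and
`BrascampLiebVacuum` would be false; `IsCompactSimpleLieGroup` (connected) excludes it". This file
proves that assertion. For a DISCRETE group every punctured neighbourhood filter `𝓝[≠] x` is `⊥`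
(`nhdsWithin_compl_singleton_eq_bot_of_discrete`), so the crux's
`slope f U e = limsup … (𝓝[≠] (U e))` is the junk value `sInf univ = 0` for EVERY `f`
(`limsup_bot_real`), hence `dir f = 0`, while a time-zero plaquette trace — which satisfies ALL
THREE hypotheses (i) gauge invariance, (ii) time-zero locality, (iii) link-Lipschitz — has positive
variance under Wilson's measure (`isOpenPosMeasure_wilsonMeasure`, `integral_sq_sub_pos`).

* `brascampLiebVacuum_false_of_discrete_at` — any discrete compact `G`, any `r` with `ρ` not
  identically `1`, any `C`, `β`, `S ≥ 1`: an admissible `f` with `dir f = 0 < Var_μ f`.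
* `not_brascampLiebVacuum_for_finite_gauge_groups` — UNCONDITIONAL: the crux with
  `IsCompactSimpleLieGroup G` replaced by "`G` finite and non-abelian" (every other symbol verbatim)
  is false (witness `S₃` with the discrete topology and its permutation representation on `ℂ³`).
  So any proof of the crux must use connectedness / non-discreteness of `G` (through the
  non-degeneracy of the metric slope), not only compactness and a faithful unitary representation.

Self-contained on top of the toolkit (the plaquette-trace facts are inlined as `have`s, cf.
`Negative/FalseWithoutLocality.lean` for the named versions).
-/

noncomputable section

open scoped BigOperators Topology Matrix Matrix.Norms.Frobenius
open Filter MeasureTheory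
open Literature.MathematicalPhysics.QuantumFieldTheory

namespace Summit.QuantumFields.YangMills.Theorems.BrascampLiebVacuum.Negative

section Discrete

/-- On `ℝ` every `limsup` along `⊥` is the junk value `sInf univ = 0`. [folklore] -/
theorem limsup_bot_real {α : Type*} (u : α → ℝ) : Filter.limsup u (⊥ : Filter α) = 0 := by
  rw [Filter.limsup_eq]
  simp only [Filter.eventually_bot, Set.setOf_true]
  exact Real.sInf_of_not_bddBelow not_bddBelow_univ

/-- In a discrete space punctured neighbourhood filters are trivial. [folklore] -/
theorem nhdsWithin_compl_singleton_eq_bot_of_discrete {X : Type*} [TopologicalSpace X]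
    [DiscreteTopology X] (x : X) : 𝓝[≠] x = ⊥ := by
  rw [← Filter.empty_mem_iff_bot, mem_nhdsWithin]
  exact ⟨{x}, isOpen_discrete _, rfl, fun y hy => hy.2 hy.1⟩

variable {G : Type*} [Group G] [TopologicalSpace G] [IsTopologicalGroup G] [CompactSpace G]
  [MeasurableSpace G] [BorelSpace G]

/-- **For a discrete gauge group the crux's inequality fails on every torus `S ≥ 1`**, with a test
function satisfying ALL of (i)–(iii): the time-zero plaquette trace `Re tr ρ(U_p)` has every
`slope` equal to `limsup _ ⊥ = 0`, so `dir f = 0`, and positive variance as soon as `ρ` is not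
identically `1` (e.g. `G` non-trivial, `ρ` faithful). [folklore] -/
theorem brascampLiebVacuum_false_of_discrete_at [DiscreteTopology G] (r : LatticeRep G)
    (hr : ∃ a : G, r.ρ a ≠ 1) (C β : ℝ) {S : ℕ} (hS : 1 ≤ S) :
    let μ := wilsonMeasure (d := 4) (L := 2 * S + 1) r.ρ β
    let fro : Matrix (Fin r.N) (Fin r.N) ℂ → ℝ := fun M => ∑ a, ∑ b, ‖M a b‖ ^ 2
    let coul : GaugeConfig 4 (2 * S + 1) G → (Site 4 (2 * S + 1) → G) → ℝ := fun U h =>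
      -∑ e : Edge 4 (2 * S + 1),
        (if e.1 0 = 0 ∧ e.2 ≠ 0 then (r.ρ (gaugeTransform h U e)).trace.re else 0)
    let cov : GaugeConfig 4 (2 * S + 1) G → (Site 4 (2 * S + 1) → G) →
        (Fin 3 → ZMod (2 * S + 1)) → ℝ := fun U h p =>
      (∑ j : Fin 3, fro (∑ y : Fin 3 → ZMod (2 * S + 1),
        Complex.exp (-(2 * Real.pi * Complex.I *
          (∑ i : Fin 3, ((p i).val : ℂ) * ((y i).val : ℂ)) / (2 * S + 1 : ℂ))) •
        ((1 / 2 : ℂ) • (r.ρ (gaugeTransform h U (Fin.cons (0 : ZMod (2 * S + 1)) y, j.succ)) -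
          (r.ρ (gaugeTransform h U (Fin.cons (0 : ZMod (2 * S + 1)) y, j.succ)))ᴴ)))) /
        ((2 * S + 1 : ℝ) ^ 3)
    let Dmax : ℝ := ⨆ p : Fin 3 → ZMod (2 * S + 1),
      ∫ U, (⨆ h : {h : Site 4 (2 * S + 1) → G // ∀ h', coul U h ≤ coul U h'}, cov U h.1 p) ∂μ
    let slope : (GaugeConfig 4 (2 * S + 1) G → ℝ) → GaugeConfig 4 (2 * S + 1) G →
        Edge 4 (2 * S + 1) → ℝ := fun f U e =>
      Filter.limsup (fun g : G => |f (Function.update U e g) - f U| /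
        Real.sqrt (fro (r.ρ g - r.ρ (U e)))) (𝓝[≠] (U e))
    let dir : (GaugeConfig 4 (2 * S + 1) G → ℝ) → ℝ := fun f =>
      ∑ e : Edge 4 (2 * S + 1), (if e.1 0 = 0 ∧ e.2 ≠ 0 then ∫ U, (slope f U e) ^ 2 ∂μ else 0)
    ∃ f : GaugeConfig 4 (2 * S + 1) G → ℝ, IsGaugeInvariant f ∧
      (∀ U V : GaugeConfig 4 (2 * S + 1) G,
        (∀ e : Edge 4 (2 * S + 1), e.1 0 = 0 → e.2 ≠ 0 → U e = V e) → f U = f V) ∧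
      (∃ K : ℝ, ∀ U V : GaugeConfig 4 (2 * S + 1) G,
        |f U - f V| ≤ K * ∑ e, Real.sqrt (fro (r.ρ (U e) - r.ρ (V e)))) ∧
      dir f = 0 ∧ C * Dmax * dir f < ∫ U, (f U - ∫ V, f V ∂μ) ^ 2 ∂μ := by
  intro μ fro coul cov Dmax slope dir
  haveI : Fact (1 < 2 * S + 1) := ⟨by omega⟩
  -- the time-zero plaquette trace at the origin: invariance, locality, values (inlined)
  have hGI : IsGaugeInvariant (fun U : GaugeConfig 4 (2 * S + 1) G => (r.ρ (plaquetteHolonomy U 0 1 2)).trace.re) := fun h U => by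
    beta_reduce
    rw [Literature.MathematicalPhysics.QuantumLattice.plaquetteHolonomy_gaugeTransform, map_mul,
      map_mul, Matrix.trace_mul_cycle, ← map_mul, inv_mul_cancel, map_one, one_mul]
  have h10 : (1 : Fin 4) ≠ 0 := by decide
  have h20 : (2 : Fin 4) ≠ 0 := by decide
  have hloc : ∀ U V : GaugeConfig 4 (2 * S + 1) G,
      (∀ e : Edge 4 (2 * S + 1), e.1 0 = 0 → e.2 ≠ 0 → U e = V e) →
      plaquetteHolonomy U 0 1 2 = plaquetteHolonomy V 0 1 2 := fun U V h => by
    unfold plaquetteHolonomy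
    rw [h (0, 1) rfl h10, h (Site.shift 0 1, 2) (by simp [Site.shift]) h20,
      h (Site.shift 0 2, 1) (by simp [Site.shift]) h10, h (0, 2) rfl h20]
  have hupd : ∀ a : G, plaquetteHolonomy
      (Function.update (1 : GaugeConfig 4 (2 * S + 1) G) ((0 : Site 4 (2 * S + 1)), 1) a) 0 1 2 = a := by
    intro a
    have h3 : ((Site.shift (0 : Site 4 (2 * S + 1)) 2, (1 : Fin 4)) : Edge 4 (2 * S + 1)) ≠ (0, 1) := by
      intro h
      have := congrArg (fun e : Edge 4 (2 * S + 1) => e.1 2) h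
      simp [Site.shift] at this
    simp [plaquetteHolonomy, Function.update_of_ne h3]
  have hcont : Continuous (fun U : GaugeConfig 4 (2 * S + 1) G => (r.ρ (plaquetteHolonomy U 0 1 2)).trace.re) :=
    Complex.continuous_re.comp (Continuous.matrix_trace (r.continuous.comp
      (Literature.MathematicalPhysics.QuantumLattice.continuous_plaquetteHolonomy 0 1 2)))
  have hN : (0 : ℝ) ≤ r.N := Nat.cast_nonneg _
  have hu : ∀ g, ‖r.ρ g‖ ≤ r.N := fun g =>
    Literature.MathematicalPhysics.QuantumLattice.norm_le_of_mem_unitaryGroup (r.mem_unitary g)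
  have huH : ∀ g, ‖(r.ρ g)ᴴ‖ ≤ r.N := fun g => by
    rw [Matrix.frobenius_norm_conjTranspose]; exact hu g
  have hlip : ∀ U V : GaugeConfig 4 (2 * S + 1) G,
      |(r.ρ (plaquetteHolonomy U 0 1 2)).trace.re - (r.ρ (plaquetteHolonomy V 0 1 2)).trace.re| ≤
        4 * (r.N : ℝ) ^ 4 * ∑ e, Real.sqrt (fro (r.ρ (U e) - r.ρ (V e))) := by
    intro U V
    show _ ≤ 4 * (r.N : ℝ) ^ 4 * ∑ e, Real.sqrt (∑ a, ∑ b, ‖(r.ρ (U e) - r.ρ (V e)) a b‖ ^ 2)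
    simp_rw [sqrt_sum_sq_eq_norm]
    unfold plaquetteHolonomy
    simp only [map_mul, map_inv_eq_conjTranspose r.ρ r.mem_unitary]
    rw [← Complex.sub_re, ← Matrix.trace_sub]
    refine (UnitaryCayley.abs_re_trace_le _).trans ?_
    have h4 := norm_mul₄_sub_mul₄_le (A := r.ρ (U (0, 1))) (A' := r.ρ (V (0, 1)))
      (B := r.ρ (U (Site.shift 0 1, 2))) (B' := r.ρ (V (Site.shift 0 1, 2)))
      (C := (r.ρ (U (Site.shift 0 2, 1)))ᴴ) (C' := (r.ρ (V (Site.shift 0 2, 1)))ᴴ)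
      (D := (r.ρ (U (0, 2)))ᴴ) (D' := (r.ρ (V (0, 2)))ᴴ)
      hN (hu _) (huH _) (huH _) (hu _) (hu _) (huH _)
    rw [← Matrix.conjTranspose_sub, ← Matrix.conjTranspose_sub, Matrix.frobenius_norm_conjTranspose,
      Matrix.frobenius_norm_conjTranspose] at h4
    have hs : ∀ e₀ : Edge 4 (2 * S + 1),
        ‖r.ρ (U e₀) - r.ρ (V e₀)‖ ≤ ∑ e, ‖r.ρ (U e) - r.ρ (V e)‖ := fun e₀ =>
      Finset.single_le_sum (f := fun e => ‖r.ρ (U e) - r.ρ (V e)‖) (fun _ _ => norm_nonneg _)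
        (Finset.mem_univ e₀)
    have hsum := add_le_add (add_le_add (add_le_add (hs (0, 1)) (hs (Site.shift 0 1, 2)))
      (hs (Site.shift 0 2, 1))) (hs (0, 2))
    calc (r.N : ℝ) * ‖_‖ ≤ r.N * ((r.N : ℝ) ^ 3 * (4 * ∑ e, ‖r.ρ (U e) - r.ρ (V e)‖)) := by
          refine mul_le_mul_of_nonneg_left (h4.trans ?_) hN
          refine mul_le_mul_of_nonneg_left ?_ (by positivity)
          linarith
      _ = 4 * (r.N : ℝ) ^ 4 * ∑ e, ‖r.ρ (U e) - r.ρ (V e)‖ := by ring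
  refine ⟨(fun U : GaugeConfig 4 (2 * S + 1) G => (r.ρ (plaquetteHolonomy U 0 1 2)).trace.re), hGI,
    fun U V hUV => by beta_reduce; rw [hloc U V hUV], ⟨4 * (r.N : ℝ) ^ 4, hlip⟩, ?_⟩
  have hdir : dir (fun U : GaugeConfig 4 (2 * S + 1) G => (r.ρ (plaquetteHolonomy U 0 1 2)).trace.re) = 0 := by
    show (∑ e : Edge 4 (2 * S + 1), (if e.1 0 = 0 ∧ e.2 ≠ 0 then
      ∫ U, (slope (fun U : GaugeConfig 4 (2 * S + 1) G => (r.ρ (plaquetteHolonomy U 0 1 2)).trace.re) U e) ^ 2 ∂μ else 0)) = 0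
    refine Finset.sum_eq_zero fun e _ => ?_
    split_ifs with he
    · have : ∀ U, slope (fun U : GaugeConfig 4 (2 * S + 1) G => (r.ρ (plaquetteHolonomy U 0 1 2)).trace.re) U e = 0 := fun U => by
        show Filter.limsup _ _ = 0
        rw [nhdsWithin_compl_singleton_eq_bot_of_discrete]
        exact limsup_bot_real _
      simp [this]
    · rfl
  refine ⟨hdir, ?_⟩
  rw [hdir, mul_zero]
  haveI : SecondCountableTopology G :=
    (r.continuous.isClosedEmbedding r.injective).isEmbedding.secondCountableTopology
  haveI := isOpenPosMeasure_wilsonMeasure (d := 4) (L := 2 * S + 1) r.ρ r.continuous β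
  haveI := isProbabilityMeasure_wilsonMeasure (d := 4) (L := 2 * S + 1) r.ρ r.continuous β
  obtain ⟨a, ha⟩ := hr
  have hlt := re_trace_lt_of_ne_one (r.mem_unitary a) ha
  have hne : (fun U : GaugeConfig 4 (2 * S + 1) G => (r.ρ (plaquetteHolonomy U 0 1 2)).trace.re) 1 ≠
      (fun U : GaugeConfig 4 (2 * S + 1) G => (r.ρ (plaquetteHolonomy U 0 1 2)).trace.re)
        (Function.update (1 : GaugeConfig 4 (2 * S + 1) G) ((0 : Site 4 (2 * S + 1)), 1) a) := by
    beta_reduce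
    rw [Literature.MathematicalPhysics.QuantumLattice.plaquetteHolonomy_one, hupd a, map_one,
      Matrix.trace_one, Fintype.card_fin, Complex.natCast_re]
    exact hlt.ne'
  exact integral_sq_sub_pos μ hcont hne _

end Discrete

section Finite

/-- The permutation matrices of `S₃` on `ℂ³` are unitary. [folklore] -/
theorem permMatrix_mem_unitaryGroup (σ : Equiv.Perm (Fin 3)) :
    Equiv.Perm.permMatrix ℂ σ ∈ Matrix.unitaryGroup (Fin 3) ℂ := by
  rw [Matrix.mem_unitaryGroup_iff', Matrix.star_eq_conjTranspose]
  have hH : (Equiv.Perm.permMatrix ℂ σ)ᴴ = (Equiv.Perm.permMatrix ℂ σ)ᵀ := by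
    ext i j
    simp [Matrix.conjTranspose_apply, Equiv.Perm.permMatrix, PEquiv.toMatrix_apply, apply_ite]
  rw [hH, Matrix.transpose_permMatrix, ← Matrix.permMatrix_mul, mul_inv_cancel,
    Matrix.permMatrix_one]

/-- **The crux's shape is false for finite non-abelian gauge groups (unconditionally).**
`ConvexGribovBody.BrascampLiebVacuum` with the hypothesis `IsCompactSimpleLieGroup G` replaced by
"`G` finite and non-abelian" (every other symbol verbatim) fails: take `G = S₃` with the discrete
topology (compact, Borel = `⊤`), the faithful unitary permutation representation `σ ↦ P_{σ⁻¹}` on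
`ℂ³`, and apply `brascampLiebVacuum_false_of_discrete_at` on the torus `S = max S₀ 1`. Hence the
connectedness clause of `IsSimpleCompactGroup` is used essentially by any proof of the crux. [folklore] -/
theorem not_brascampLiebVacuum_for_finite_gauge_groups :
    ¬ (∀ (G : Type) [Group G] [TopologicalSpace G] [IsTopologicalGroup G] [CompactSpace G]
      [MeasurableSpace G] [BorelSpace G], Finite G → (∃ a b : G, a * b ≠ b * a) →
      ∀ r : LatticeRep G,
      ∃ C : ℝ, 0 < C ∧ ∃ β₀ : ℝ, ∀ β : ℝ, β₀ ≤ β → ∃ S₀ : ℕ, ∀ S : ℕ, S₀ ≤ S →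
      let μ := wilsonMeasure (d := 4) (L := 2 * S + 1) r.ρ β
      let fro : Matrix (Fin r.N) (Fin r.N) ℂ → ℝ := fun M => ∑ a, ∑ b, ‖M a b‖ ^ 2
      let coul : GaugeConfig 4 (2 * S + 1) G → (Site 4 (2 * S + 1) → G) → ℝ := fun U h =>
        -∑ e : Edge 4 (2 * S + 1),
          (if e.1 0 = 0 ∧ e.2 ≠ 0 then (r.ρ (gaugeTransform h U e)).trace.re else 0)
      let cov : GaugeConfig 4 (2 * S + 1) G → (Site 4 (2 * S + 1) → G) →
          (Fin 3 → ZMod (2 * S + 1)) → ℝ := fun U h p =>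
        (∑ j : Fin 3, fro (∑ y : Fin 3 → ZMod (2 * S + 1),
          Complex.exp (-(2 * Real.pi * Complex.I *
            (∑ i : Fin 3, ((p i).val : ℂ) * ((y i).val : ℂ)) / (2 * S + 1 : ℂ))) •
          ((1 / 2 : ℂ) • (r.ρ (gaugeTransform h U (Fin.cons (0 : ZMod (2 * S + 1)) y, j.succ)) -
            (r.ρ (gaugeTransform h U (Fin.cons (0 : ZMod (2 * S + 1)) y, j.succ)))ᴴ)))) /
          ((2 * S + 1 : ℝ) ^ 3)
      let Dmax : ℝ := ⨆ p : Fin 3 → ZMod (2 * S + 1),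
        ∫ U, (⨆ h : {h : Site 4 (2 * S + 1) → G // ∀ h', coul U h ≤ coul U h'}, cov U h.1 p) ∂μ
      let slope : (GaugeConfig 4 (2 * S + 1) G → ℝ) → GaugeConfig 4 (2 * S + 1) G →
          Edge 4 (2 * S + 1) → ℝ := fun f U e =>
        Filter.limsup (fun g : G => |f (Function.update U e g) - f U| /
          Real.sqrt (fro (r.ρ g - r.ρ (U e)))) (𝓝[≠] (U e))
      let dir : (GaugeConfig 4 (2 * S + 1) G → ℝ) → ℝ := fun f =>
        ∑ e : Edge 4 (2 * S + 1), (if e.1 0 = 0 ∧ e.2 ≠ 0 then ∫ U, (slope f U e) ^ 2 ∂μ else 0)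
      ∀ f : GaugeConfig 4 (2 * S + 1) G → ℝ, IsGaugeInvariant f →
        (∀ U V : GaugeConfig 4 (2 * S + 1) G,
          (∀ e : Edge 4 (2 * S + 1), e.1 0 = 0 → e.2 ≠ 0 → U e = V e) → f U = f V) →
        (∃ K : ℝ, ∀ U V : GaugeConfig 4 (2 * S + 1) G,
          |f U - f V| ≤ K * ∑ e, Real.sqrt (fro (r.ρ (U e) - r.ρ (V e)))) →
        ∫ U, (f U - ∫ V, f V ∂μ) ^ 2 ∂μ ≤ C * Dmax * dir f) := by
  intro hBL
  letI : TopologicalSpace (Equiv.Perm (Fin 3)) := ⊥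
  haveI : DiscreteTopology (Equiv.Perm (Fin 3)) := ⟨rfl⟩
  haveI : IsTopologicalGroup (Equiv.Perm (Fin 3)) :=
    { continuous_mul := continuous_of_discreteTopology
      continuous_inv := continuous_of_discreteTopology }
  letI : MeasurableSpace (Equiv.Perm (Fin 3)) := ⊤
  haveI : BorelSpace (Equiv.Perm (Fin 3)) := ⟨(borel_eq_top_of_discrete).symm⟩
  -- the permutation representation `σ ↦ P_{σ⁻¹}`
  let ρ : Equiv.Perm (Fin 3) →* Matrix (Fin 3) (Fin 3) ℂ :=
    { toFun := fun σ => Equiv.Perm.permMatrix ℂ σ⁻¹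
      map_one' := by simp [Matrix.permMatrix_one]
      map_mul' := fun σ τ => by
        simp only [mul_inv_rev, Matrix.permMatrix_mul] }
  have hρ : ∀ σ, ρ σ = Equiv.Perm.permMatrix ℂ σ⁻¹ := fun σ => rfl
  have hinj : Function.Injective ρ := by
    intro σ τ h
    rw [hρ, hρ] at h
    have h' : (Equiv.toPEquiv σ⁻¹) = Equiv.toPEquiv τ⁻¹ := PEquiv.toMatrix_injective h
    have : σ⁻¹ = τ⁻¹ := Equiv.ext fun x => by
      have := congrArg (fun f : Fin 3 ≃. Fin 3 => f x) h'
      simpa using this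
    exact inv_injective this
  let r : LatticeRep (Equiv.Perm (Fin 3)) :=
    ⟨3, ρ, continuous_of_discreteTopology, hinj, fun σ => permMatrix_mem_unitaryGroup σ⁻¹⟩
  have hab : ∃ a b : Equiv.Perm (Fin 3), a * b ≠ b * a :=
    ⟨Equiv.swap 0 1, Equiv.swap 1 2, by decide⟩
  obtain ⟨C, -, β₀, h⟩ := hBL (Equiv.Perm (Fin 3)) inferInstance hab r
  obtain ⟨S₀, hS₀⟩ := h β₀ le_rfl
  have h1 := hS₀ (max S₀ 1) (le_max_left _ _)
  have hr : ∃ a : Equiv.Perm (Fin 3), r.ρ a ≠ 1 := by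
    refine ⟨Equiv.swap 0 1, fun h => ?_⟩
    have : Equiv.swap (0 : Fin 3) 1 = 1 := r.injective (by rw [h, map_one])
    exact absurd this (by decide)
  obtain ⟨f, hf₁, hf₂, hf₃, -, hlt⟩ := brascampLiebVacuum_false_of_discrete_at r hr C β₀
    (S := max S₀ 1) (le_max_right _ _)
  exact absurd (h1 f hf₁ hf₂ hf₃) (not_le.2 hlt)

end Finite

end Summit.QuantumFields.YangMills.Theorems.BrascampLiebVacuum.Negative

end
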